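import Summits.CriticalPhenomena.PercolationContinuityZ3.Theorems.SahiMasterFamilyFCombShiftMatching

/-!
# Cube transfer: set families on a ground finset `R` versus families in the cube of the subtype `↥R` (support file)

Support file (prover seat `prim-bnk-2`, gen 31; `--supports stmt-CriticalPhenomena-4575`).  Memo:
`run/shared/lean/prim/prim-l12/FROM-prim-bnk-2-g31-COMPRESSION-THEOREM.md` §6.

The `SahiFComb.Shift` toolkit (THEOREM S, `(♣)`, THEOREM S^rel, LEMMA I** …) is written for families of subsets of a finite TYPE
(`[Fintype α]`, complement `σ = univ \ ·`, compression lists containing every coordinate).  SCHEME Σ (g30) needs these statements on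
SUB-cubes `2^R`, `R ⊊ ι` (the I-cubes `I \ y_I`, the J-cubes `J \ w`).  This file is the transfer kit: `resFam R X`, the restriction
of a family of subsets of `R` to the cube of the subtype `↥R`, commutes with down-compression (`resFam_compression`, `resFam_downs`),
with relative complement (`resFam_image_sdiff`), set difference, cardinality and closedness, and dominating bijections descend
(`exists_dominating_equiv_of_resFam`).  As a first application, `(♣)`/Kleitman–Hall on a ground finset:
`exists_dominating_equiv_ground` (from `exists_dominating_equiv`).

One plumbing definition (`resFam`); no `sorry`; standard axioms.
-/

namespace Summit.CriticalPhenomena.PercolationContinuityZ3.Theorems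

namespace SahiFComb.Shift

open Finset FinsetFamily

variable {α : Type*} [DecidableEq α] (R : Finset α)

/-! ### 1. Restriction to the subtype cube -/

/-- Restriction of a family of subsets of the ground finset `R` to the cube of the subtype `↥R`. [this work] -/
def resFam (X : Finset (Finset α)) : Finset (Finset ↥R) :=
  X.image fun s => s.subtype (· ∈ R)

omit [DecidableEq α] in
/-- A finset of the subtype, pushed to `α`, lies inside the ground finset. [folklore] -/
theorem map_subtype_subset_ground (t : Finset ↥R) : t.map (Function.Embedding.subtype (· ∈ R)) ⊆ R := by
  intro a ha
  obtain ⟨y, -, rfl⟩ := mem_map.1 ha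
  exact y.2

/-- Pushing to `α` and restricting back is the identity. [folklore] -/
theorem subtype_map_subtype (t : Finset ↥R) :
    (t.map (Function.Embedding.subtype (· ∈ R))).subtype (· ∈ R) = t := by
  ext x
  rw [mem_subtype]
  constructor
  · intro h
    obtain ⟨y, hy, hyx⟩ := mem_map.1 h
    have : y = x := Subtype.ext hyx
    exact this ▸ hy
  · intro h
    exact mem_map.2 ⟨x, h, rfl⟩

/-- Membership in the restricted family. [this work] -/
theorem mem_resFam {X : Finset (Finset α)} (hX : ∀ s ∈ X, s ⊆ R) {t : Finset ↥R} :
    t ∈ resFam R X ↔ t.map (Function.Embedding.subtype (· ∈ R)) ∈ X := by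
  unfold resFam
  rw [mem_image]
  constructor
  · rintro ⟨s, hs, rfl⟩
    rw [subtype_map_of_mem (hX s hs)]
    exact hs
  · intro h
    exact ⟨_, h, subtype_map_subtype R t⟩

/-- Membership of a restricted set in the restricted family. [this work] -/
theorem subtype_mem_resFam_iff {X : Finset (Finset α)} (hX : ∀ s ∈ X, s ⊆ R) {s : Finset α} (hs : s ⊆ R) :
    s.subtype (· ∈ R) ∈ resFam R X ↔ s ∈ X := by
  rw [mem_resFam R hX, subtype_map_of_mem hs]

/-- Restriction is injective on the subsets of the ground finset. [folklore] -/
theorem subtype_injOn_ground {X : Finset (Finset α)} (hX : ∀ s ∈ X, s ⊆ R) :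
    Set.InjOn (fun s : Finset α => s.subtype (· ∈ R)) (X : Set (Finset α)) := by
  intro s hs s' hs' h
  have h' := congrArg (fun t : Finset ↥R => t.map (Function.Embedding.subtype (· ∈ R))) h
  simp only at h'
  rwa [subtype_map_of_mem (hX s hs), subtype_map_of_mem (hX s' hs')] at h'

/-- Restriction preserves the size of the family. [this work] -/
theorem card_resFam {X : Finset (Finset α)} (hX : ∀ s ∈ X, s ⊆ R) : #(resFam R X) = #X :=
  card_image_of_injOn (subtype_injOn_ground R hX)

/-- Relative complement becomes complement. [this work] -/
theorem subtype_ground_sdiff (s : Finset α) : (R \ s).subtype (· ∈ R) = (s.subtype (· ∈ R))ᶜ := by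
  ext x
  simp only [mem_subtype, mem_sdiff, mem_compl, x.2, true_and]

/-- Restriction turns the relative complements `R \ ·` into complements. [this work] -/
theorem resFam_image_sdiff (X : Finset (Finset α)) :
    resFam R (X.image fun s => R \ s) = (resFam R X).image compl := by
  unfold resFam
  rw [image_image, image_image]
  exact image_congr fun s _ => subtype_ground_sdiff R s

/-- Restriction commutes with set difference of families. [this work] -/
theorem resFam_sdiff {X Y : Finset (Finset α)} (hX : ∀ s ∈ X, s ⊆ R) (hY : ∀ s ∈ Y, s ⊆ R) :
    resFam R (X \ Y) = resFam R X \ resFam R Y := by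
  ext t
  rw [mem_resFam R (fun s hs => hX s (mem_sdiff.1 hs).1), mem_sdiff, mem_sdiff, mem_resFam R hX, mem_resFam R hY]

/-- Restriction commutes with intersection of families. [this work] -/
theorem resFam_inter {X Y : Finset (Finset α)} (hX : ∀ s ∈ X, s ⊆ R) (hY : ∀ s ∈ Y, s ⊆ R) :
    resFam R (X ∩ Y) = resFam R X ∩ resFam R Y := by
  ext t
  rw [mem_resFam R (fun s hs => hX s (mem_inter.1 hs).1), mem_inter, mem_inter, mem_resFam R hX, mem_resFam R hY]

/-- Members of a down-compression of a family on `R` stay inside `R`. [folklore] -/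
theorem subset_ground_of_mem_compression {X : Finset (Finset α)} (hX : ∀ s ∈ X, s ⊆ R) (a : α) :
    ∀ s ∈ 𝓓 a X, s ⊆ R := by
  intro s hs
  rcases Down.mem_compression.1 hs with ⟨h, -⟩ | ⟨-, h⟩
  · exact hX s h
  · exact (subset_insert a s).trans (hX _ h)

/-- Members of an iterated down-compression of a family on `R` stay inside `R`. [folklore] -/
theorem subset_ground_of_mem_downs :
    ∀ (l : List α) {X : Finset (Finset α)}, (∀ s ∈ X, s ⊆ R) → ∀ s ∈ l.foldl (fun 𝒴 i => 𝓓 i 𝒴) X, s ⊆ R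
  | [], _, hX => hX
  | a :: l, _, hX => subset_ground_of_mem_downs l (subset_ground_of_mem_compression R hX a)

/-- Restriction commutes with down-compression along a coordinate of `R`. [this work] -/
theorem resFam_compression {a : α} (ha : a ∈ R) {X : Finset (Finset α)} (hX : ∀ s ∈ X, s ⊆ R) :
    resFam R (𝓓 a X) = 𝓓 ⟨a, ha⟩ (resFam R X) := by
  ext t
  rw [mem_resFam R (subset_ground_of_mem_compression R hX a), Down.mem_compression, Down.mem_compression,
    mem_resFam R hX, mem_resFam R hX, mem_resFam R hX, map_erase, map_insert]
  rfl

/-- Restriction commutes with iterated down-compression along coordinates of `R`. [this work] -/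
theorem resFam_downs :
    ∀ (l : List α) (hl : ∀ a ∈ l, a ∈ R) {X : Finset (Finset α)}, (∀ s ∈ X, s ⊆ R) →
      resFam R (l.foldl (fun 𝒴 i => 𝓓 i 𝒴) X) =
        (l.pmap (fun a h => (⟨a, h⟩ : ↥R)) hl).foldl (fun 𝒴 i => 𝓓 i 𝒴) (resFam R X)
  | [], _, _, _ => rfl
  | a :: l, hl, X, hX => by
    rw [List.foldl_cons, List.pmap, List.foldl_cons,
      resFam_downs l (fun b hb => hl b (List.mem_cons_of_mem a hb)) (subset_ground_of_mem_compression R hX a),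
      resFam_compression R (hl a List.mem_cons_self) hX]

omit [DecidableEq α] in
/-- The coordinate list of `R` transferred to the subtype is duplicate-free. [folklore] -/
theorem nodup_pmap_mk {l : List α} (hl : l.Nodup) (hlR : ∀ a ∈ l, a ∈ R) :
    (l.pmap (fun a h => (⟨a, h⟩ : ↥R)) hlR).Nodup :=
  hl.pmap fun _ _ _ _ h => congrArg Subtype.val h

omit [DecidableEq α] in
/-- The coordinate list of `R` transferred to the subtype is complete. [folklore] -/
theorem mem_pmap_mk {l : List α} (hlR : ∀ a ∈ l, a ∈ R) (hRl : ∀ a ∈ R, a ∈ l) (b : ↥R) :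
    b ∈ l.pmap (fun a h => (⟨a, h⟩ : ↥R)) hlR :=
  List.mem_pmap.2 ⟨b.1, hRl b.1 b.2, rfl⟩

/-- An up-closed family of the cube `2^R` restricts to an up-closed family. [this work] -/
theorem upClosed_resFam {X : Finset (Finset α)} (hX : ∀ s ∈ X, s ⊆ R)
    (hup : ∀ s ∈ X, ∀ s', s ⊆ s' → s' ⊆ R → s' ∈ X) :
    ∀ K ∈ resFam R X, ∀ K', K ⊆ K' → K' ∈ resFam R X := by
  intro K hK K' hKK'
  rw [mem_resFam R hX] at hK ⊢
  exact hup _ hK _ (map_subset_map.2 hKK') (map_subtype_subset_ground R K')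

/-- A family whose restriction is down-closed is down-closed. [this work] -/
theorem downClosed_of_resFam {X : Finset (Finset α)} (hX : ∀ s ∈ X, s ⊆ R)
    (hdown : ∀ K ∈ resFam R X, ∀ K' ⊆ K, K' ∈ resFam R X) : ∀ s ∈ X, ∀ s' ⊆ s, s' ∈ X := by
  intro s hs s' hs's
  have h1 : s.subtype (· ∈ R) ∈ resFam R X := (subtype_mem_resFam_iff R hX (hX s hs)).2 hs
  have h2 := hdown _ h1 _ (subtype_mono hs's)
  exact (subtype_mem_resFam_iff R hX (hs's.trans (hX s hs))).1 h2

/-- **Dominating bijections descend from the subtype cube.** [this work] -/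
theorem exists_dominating_equiv_of_resFam {X Y : Finset (Finset α)} (hX : ∀ s ∈ X, s ⊆ R) (hY : ∀ s ∈ Y, s ⊆ R)
    (h : ∃ e : ↥(resFam R X) ≃ ↥(resFam R Y), ∀ x : ↥(resFam R X), (x : Finset ↥R) ⊆ (e x : Finset ↥R)) :
    ∃ e : ↥X ≃ ↥Y, ∀ x : ↥X, (x : Finset α) ⊆ (e x : Finset α) := by
  obtain ⟨e, he⟩ := h
  -- the bijections `resFam R X ≃ X`, `resFam R Y ≃ Y` given by pushing to `α`
  let fX : ↥(resFam R X) → ↥X := fun t => ⟨(t : Finset ↥R).map (Function.Embedding.subtype (· ∈ R)), (mem_resFam R hX).1 t.2⟩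
  let fY : ↥(resFam R Y) → ↥Y := fun t => ⟨(t : Finset ↥R).map (Function.Embedding.subtype (· ∈ R)), (mem_resFam R hY).1 t.2⟩
  have hfX : Function.Bijective fX := by
    rw [Fintype.bijective_iff_injective_and_card]
    refine ⟨fun t t' h => Subtype.ext (map_injective _ (congrArg Subtype.val h)), ?_⟩
    rw [Fintype.card_coe, Fintype.card_coe, card_resFam R hX]
  have hfY : Function.Bijective fY := by
    rw [Fintype.bijective_iff_injective_and_card]
    refine ⟨fun t t' h => Subtype.ext (map_injective _ (congrArg Subtype.val h)), ?_⟩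
    rw [Fintype.card_coe, Fintype.card_coe, card_resFam R hY]
  let eX := Equiv.ofBijective fX hfX
  let eY := Equiv.ofBijective fY hfY
  refine ⟨eX.symm.trans (e.trans eY), fun x => ?_⟩
  have hx : (x : Finset α) = ((eX.symm x : ↥(resFam R X)) : Finset ↥R).map (Function.Embedding.subtype (· ∈ R)) := by
    have := eX.apply_symm_apply x
    exact (congrArg Subtype.val this).symm
  rw [hx]
  exact map_subset_map.2 (he (eX.symm x))

/-! ### 2. `(♣)` / Kleitman–Hall on a ground finset -/

/-- **`(♣)` on a ground finset** (`exists_dominating_equiv` transferred): for a family `G` of subsets of `R`, up-closed inside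
`2^R`, `σ = R \ ·`, `H = σG ∩ G`, `𝒦 = D_l H` for a duplicate-free list `l` of elements of `R`, there is a bijection
`φ : σG \ G ≃ G \ σ𝒦` with `x ⊆ φ x` (Kleitman–Hall on the cube `2^R` is the case `l = []`). [this work] -/
theorem exists_dominating_equiv_ground [LinearOrder α] (G : Finset (Finset α)) (hGR : ∀ s ∈ G, s ⊆ R)
    (hG : ∀ K ∈ G, ∀ K', K ⊆ K' → K' ⊆ R → K' ∈ G) (l : List α) (hl : l.Nodup) (hlR : ∀ a ∈ l, a ∈ R)
    (𝒦 : Finset (Finset α)) (h𝒦 : 𝒦 = l.foldl (fun 𝒴 i => 𝓓 i 𝒴) (G.image (fun s => R \ s) ∩ G)) :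
    ∃ φ : ↥(G.image (fun s => R \ s) \ G) ≃ ↥(G \ 𝒦.image fun s => R \ s),
      ∀ x : ↥(G.image (fun s => R \ s) \ G), (x : Finset α) ⊆ ((φ x : ↥(G \ 𝒦.image fun s => R \ s)) : Finset α) := by
  have hσR : ∀ (Y : Finset (Finset α)), ∀ s ∈ Y.image (fun s => R \ s), s ⊆ R := by
    intro Y s hs
    obtain ⟨t, -, rfl⟩ := mem_image.1 hs
    exact sdiff_subset
  have hHR : ∀ s ∈ G.image (fun s => R \ s) ∩ G, s ⊆ R := fun s hs => hGR s (mem_inter.1 hs).2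
  have h𝒦R : ∀ s ∈ 𝒦, s ⊆ R := h𝒦 ▸ subset_ground_of_mem_downs R l hHR
  -- the transferred data
  set l' : List ↥R := l.pmap (fun a h => (⟨a, h⟩ : ↥R)) hlR with hl'
  have hG' : ∀ K ∈ resFam R G, ∀ K', K ⊆ K' → K' ∈ resFam R G := upClosed_resFam R hGR hG
  have h𝒦' : resFam R 𝒦 = l'.foldl (fun 𝒴 i => 𝓓 i 𝒴) ((resFam R G).image compl ∩ resFam R G) := by
    rw [h𝒦, resFam_downs R l hlR hHR, resFam_inter R (hσR G) hGR, resFam_image_sdiff]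
  obtain ⟨φ', hφ'⟩ := exists_dominating_equiv (resFam R G) hG' l' (nodup_pmap_mk R hl hlR) (resFam R 𝒦) h𝒦'
  have h1 : (resFam R G).image compl \ resFam R G = resFam R (G.image (fun s => R \ s) \ G) := by
    rw [resFam_sdiff R (hσR G) hGR, resFam_image_sdiff]
  have h2 : resFam R G \ (resFam R 𝒦).image compl = resFam R (G \ 𝒦.image fun s => R \ s) := by
    rw [resFam_sdiff R hGR (hσR 𝒦), resFam_image_sdiff]
  refine exists_dominating_equiv_of_resFam R (fun s hs => hσR G s (mem_sdiff.1 hs).1)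
    (fun s hs => hGR s (mem_sdiff.1 hs).1) ?_
  rw [← h1, ← h2]
  exact ⟨φ', hφ'⟩

end SahiFComb.Shift

end Summit.CriticalPhenomena.PercolationContinuityZ3.Theorems
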